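import Mathlib

/-!
# Crux `ExactCertificate` (stmt-AtomisticToContinuum-11959), line `closure-makes-nogap-exact`,
# skeleton VIII (`InvisibilityDichotomy`): stub `stub_normsSuperlinear`

Support file for the crux `ThreeConeCertificate.ExactCertificate`, skeleton VIII
(`Cruxes.ExactCertificate.Invisibility`), which proves that no nonzero finite-range continuous
radial kernel on `ℝ³` has Fourier transform vanishing on a lattice minus `0`: an entire function
of exponential type vanishing at every norm `‖n k₁ + j k₂‖`, `(n, j) ≠ (0, 0)`, of a rank-2
lattice has too many zeros, because a nonzero such function has at most `C₂ R + C₁` zeros in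
`[0, R]`, while (this file) for EVERY pair of constants `C₁, C₂` the DISTINCT such norms `≤ R`
eventually number more than `C₂ R + C₁`.

Proof (elementary counting).  Gram data `A = ‖k₁‖² > 0`, `B = ⟪k₁, k₂⟫`, `C = ‖k₂‖²`, with
`B² < AC` by independence, and `‖n k₁ + j k₂‖² = A n² + 2 B j n + C j²`.  Take the `J` lines
`j = 1, …, J`, `J ≥ 2 C₂⁺ ‖k₁‖ + 1`, and on each the points `1 ≤ n ≤ N`.  The cross-line
coincidences `‖n k₁ + j k₂‖ = ‖m k₁ + j' k₂‖`, `j ≠ j'` in `[1, J]`, involve only finitely many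
points `(n, j)` (the finiteness hypothesis, which is the statement of the neighbouring stub
`stub_coincidenceFinite`), say `K` of them, and `K` does not depend on `N`.  Off these bad points
the norm map is at most 2-to-1 (on a fixed line, `A n² + 2 B j n = A m² + 2 B j m` forces `m = n`
or `m = -2 B j / A - n`), so there are at least `(N J - K) / 2` distinct norms, all at most
`R := N ‖k₁‖ + J ‖k₂‖ + 1`, and `(N J - K) / 2 > C₂⁺ R + C₁⁺ ≥ C₂ R + C₁` as soon as
`N > 2 C₂⁺ (J ‖k₂‖ + 1) + 2 C₁⁺ + K`.  Pure Mathlib (`Finset.card_le_mul_card_image`,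
`LinearIndependent.pair_iff`, `Set.Finite.biUnion`, `Nat.le_ceil`); private helper lemmas only,
no named facts.  All `[folklore]`.
-/

noncomputable section

namespace Summit.AtomisticToContinuum.Crystallization.Theorems.ThreeConeCertificateExactCertificate.Invisibility

open scoped RealInnerProductSpace

/-- Pigeonhole with fibres of size at most two: if any two points of `s` with the same value
`f p = f q` satisfy `q = p` or `q = g p`, then `#s ≤ 2 · #(f '' s)`. [folklore] -/
private theorem card_le_two_mul_card_image {α β : Type*} [DecidableEq α] [DecidableEq β]
    (s : Finset α) (f : α → β) (g : α → α)
    (h : ∀ p ∈ s, ∀ q ∈ s, f p = f q → q = p ∨ q = g p) :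
    s.card ≤ 2 * (s.image f).card := by
  refine Finset.card_le_mul_card_image s 2 fun b hb => ?_
  obtain ⟨p, hp, rfl⟩ := Finset.mem_image.1 hb
  calc (s.filter fun q => f q = f p).card ≤ ({p, g p} : Finset α).card := by
        refine Finset.card_le_card fun q hq => ?_
        rw [Finset.mem_filter] at hq
        rcases h p hp q hq.1 hq.2.symm with h1 | h1 <;> simp [h1]
    _ ≤ 2 := Finset.card_le_two

/-- Same-line fibres: for `A > 0` and integers `n, m, j`, the coincidence
`A n² + 2 B j n + C j² = A m² + 2 B j m + C j²` forces `m = n` or `m = ⌊-2 B j / A - n⌋`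
(factor `(m - n) (A (m + n) + 2 B j) = 0`). [folklore] -/
private theorem same_line {A B C : ℝ} (hA : 0 < A) {n m j : ℤ}
    (h : A * (n : ℝ) ^ 2 + 2 * B * (j : ℝ) * (n : ℝ) + C * (j : ℝ) ^ 2 =
      A * (m : ℝ) ^ 2 + 2 * B * (j : ℝ) * (m : ℝ) + C * (j : ℝ) ^ 2) :
    m = n ∨ m = ⌊-2 * B * (j : ℝ) / A - (n : ℝ)⌋ := by
  by_cases hmn : m = n
  · exact Or.inl hmn
  refine Or.inr ?_
  have hne : (m : ℝ) - n ≠ 0 := sub_ne_zero.2 (by exact_mod_cast hmn)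
  have h1 : ((m : ℝ) - n) * (A * (m + n) + 2 * B * j) = 0 := by
    linear_combination (-1 : ℝ) * h
  have h2 : A * ((m : ℝ) + n) + 2 * B * j = 0 := (mul_eq_zero.1 h1).resolve_left hne
  have h3 : (m : ℝ) = -2 * B * j / A - n := by
    rw [eq_sub_iff_add_eq, eq_div_iff hA.ne']
    linear_combination h2
  rw [← h3]
  exact (Int.floor_intCast m).symm

/-- The lattice quadratic form: `‖n k₁ + j k₂‖² = ‖k₁‖² n² + 2 ⟪k₁, k₂⟫ j n + ‖k₂‖² j²`.
[folklore] -/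
private theorem norm_sq_eq {E : Type*} [NormedAddCommGroup E] [InnerProductSpace ℝ E]
    (k₁ k₂ : E) (n j : ℤ) : ‖(n : ℝ) • k₁ + (j : ℝ) • k₂‖ ^ 2 =
      ‖k₁‖ ^ 2 * (n : ℝ) ^ 2 + 2 * ⟪k₁, k₂⟫ * (j : ℝ) * (n : ℝ) + ‖k₂‖ ^ 2 * (j : ℝ) ^ 2 := by
  simp only [norm_add_sq_real, norm_smul, real_inner_smul_left, real_inner_smul_right,
    Real.norm_eq_abs, mul_pow, sq_abs]
  ring

/-- Gram data of an independent pair: `‖k₁‖² > 0` and the STRICT Cauchy–Schwarz inequality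
`⟪k₁, k₂⟫² < ‖k₁‖² ‖k₂‖²` (the vector `-⟪k₁, k₂⟫ k₁ + ‖k₁‖² k₂` is nonzero by independence and
has squared norm `‖k₁‖² (‖k₁‖² ‖k₂‖² - ⟪k₁, k₂⟫²)`). [folklore] -/
private theorem gram_pos {E : Type*} [NormedAddCommGroup E] [InnerProductSpace ℝ E] {k₁ k₂ : E}
    (hli : LinearIndependent ℝ ![k₁, k₂]) :
    0 < ‖k₁‖ ^ 2 ∧ ⟪k₁, k₂⟫ ^ 2 < ‖k₁‖ ^ 2 * ‖k₂‖ ^ 2 := by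
  rw [LinearIndependent.pair_iff] at hli
  have hk₁ : k₁ ≠ 0 := fun h => one_ne_zero (hli 1 0 (by simp [h])).1
  have hA : 0 < ‖k₁‖ ^ 2 := pow_pos (norm_pos_iff.2 hk₁) 2
  refine ⟨hA, ?_⟩
  have hv : ‖(-⟪k₁, k₂⟫) • k₁ + (‖k₁‖ ^ 2) • k₂‖ ^ 2 =
      ‖k₁‖ ^ 2 * (‖k₁‖ ^ 2 * ‖k₂‖ ^ 2 - ⟪k₁, k₂⟫ ^ 2) := by
    simp only [norm_add_sq_real, norm_smul, real_inner_smul_left, real_inner_smul_right,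
      Real.norm_eq_abs, mul_pow, sq_abs]
    ring
  have hvne : (-⟪k₁, k₂⟫) • k₁ + (‖k₁‖ ^ 2) • k₂ ≠ 0 := fun h => hA.ne' (hli _ _ h).2
  have hvpos : 0 < ‖k₁‖ ^ 2 * (‖k₁‖ ^ 2 * ‖k₂‖ ^ 2 - ⟪k₁, k₂⟫ ^ 2) := by
    rw [← hv]
    exact pow_pos (norm_pos_iff.2 hvne) 2
  nlinarith [hvpos, hA]

/-- The cross-line coincidence points are finitely many: if `{(n, m) | Q n j = Q m j'}` is finite
whenever `0 ≤ j < j'`, then so is the set of points `p = (n, j)`, `1 ≤ j ≤ J`, with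
`Q n j = Q m j'` for some `m` and some `j' ≠ j` in `[1, J]`. [folklore] -/
private theorem bad_finite (Q : ℤ → ℤ → ℝ)
    (hfin : ∀ j j' : ℤ, 0 ≤ j → j < j' → {p : ℤ × ℤ | Q p.1 j = Q p.2 j'}.Finite) (J : ℤ) :
    {p : ℤ × ℤ | p.2 ∈ Set.Icc 1 J ∧
      ∃ q : ℤ × ℤ, q.2 ∈ Set.Icc 1 J ∧ q.2 ≠ p.2 ∧ Q p.1 p.2 = Q q.1 q.2}.Finite := by
  refine Set.Finite.subset ((Set.finite_Icc 1 J).biUnion fun j hj =>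
    (Set.finite_Ioc j J).biUnion fun j' hj' =>
      ((hfin j j' (zero_le_one.trans hj.1) hj'.1).image fun q : ℤ × ℤ => (q.1, j)).union
        ((hfin j j' (zero_le_one.trans hj.1) hj'.1).image fun q : ℤ × ℤ => (q.2, j'))) ?_
  rintro ⟨n, i⟩ ⟨hi, ⟨m, i'⟩, hi', hne, hQ⟩
  rcases lt_or_gt_of_ne hne with hlt | hlt
  · -- `i' < i`: `(m, n)` is a coincidence between the lines `i' < i`
    exact Set.mem_biUnion hi' (Set.mem_biUnion ⟨hlt, hi.2⟩ (Or.inr ⟨(m, n), hQ.symm, rfl⟩))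
  · -- `i < i'`: `(n, m)` is a coincidence between the lines `i < i'`
    exact Set.mem_biUnion hi (Set.mem_biUnion ⟨hlt, hi'.2⟩ (Or.inl ⟨(n, m), hQ, rfl⟩))

/-- Counting core.  Let `f` on `ℤ²` satisfy `f (n, j) ≤ a |n| + b |j|`, be at most 2-to-1 on
each line (`f p = f q` and `p.2 = q.2` force `q ∈ {p, g p}`), and have only finitely many
cross-line coincidence points among the lines `1 ≤ j ≤ J`, for every `J`.  Then for all `C₁, C₂`
some radius `R > 0` bounds more than `C₂ R + C₁` distinct values `f (n, j)`, `(n, j) ≠ (0, 0)`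
(take `J ≥ 2 C₂⁺ a + 1` lines, `K` bad points, `N > 2 C₂⁺ (J b + 1) + 2 C₁⁺ + K` points per
line, `R = N a + J b + 1`: at least `(N J - K) / 2` distinct good values). [folklore] -/
private theorem core (f : ℤ × ℤ → ℝ) (g : ℤ × ℤ → ℤ × ℤ) (a b : ℝ) (ha : 0 ≤ a) (hb : 0 ≤ b)
    (hf : ∀ p : ℤ × ℤ, f p ≤ a * |(p.1 : ℝ)| + b * |(p.2 : ℝ)|)
    (hfib : ∀ p q : ℤ × ℤ, f p = f q → p.2 = q.2 → q = p ∨ q = g p)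
    (hbad : ∀ J : ℤ, {p : ℤ × ℤ | p.2 ∈ Set.Icc 1 J ∧
      ∃ q : ℤ × ℤ, q.2 ∈ Set.Icc 1 J ∧ q.2 ≠ p.2 ∧ f p = f q}.Finite)
    (C₁ C₂ : ℝ) :
    ∃ (R : ℝ) (Z : Finset ℝ), 0 < R ∧ C₂ * R + C₁ < (Z.card : ℝ) ∧
      ∀ s ∈ Z, s ≤ R ∧ ∃ n j : ℤ, (n, j) ≠ (0, 0) ∧ s = f (n, j) := by
  -- (0) nonnegative majorants `C₁⁺ = max C₁ 0`, `C₂⁺ = max C₂ 0` of the constants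
  have hc₁ : C₁ ≤ max C₁ 0 := le_max_left _ _
  have hc₂ : C₂ ≤ max C₂ 0 := le_max_left _ _
  have hc₁0 : 0 ≤ max C₁ 0 := le_max_right _ _
  have hc₂0 : 0 ≤ max C₂ 0 := le_max_right _ _
  -- (2) the number `J` of lines
  obtain ⟨J, hJ⟩ : ∃ J : ℕ, 2 * max C₂ 0 * a + 1 ≤ J :=
    ⟨⌈2 * max C₂ 0 * a⌉₊ + 1, by push_cast; linarith [Nat.le_ceil (2 * max C₂ 0 * a)]⟩
  -- (3) the finitely many bad (cross-line coincidence) points, independent of `N`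
  set Bad : Finset (ℤ × ℤ) := (hbad J).toFinset
  -- (4) the number `N` of points per line and the domain `D = [1, N] × [1, J]`
  obtain ⟨N, hN⟩ : ∃ N : ℕ,
      2 * max C₂ 0 * (J * b + 1) + 2 * max C₁ 0 + Bad.card + 1 ≤ N :=
    ⟨⌈2 * max C₂ 0 * (J * b + 1) + 2 * max C₁ 0 + Bad.card⌉₊ + 1, by
      push_cast
      linarith [Nat.le_ceil (2 * max C₂ 0 * (J * b + 1) + 2 * max C₁ 0 + Bad.card)]⟩
  set D : Finset (ℤ × ℤ) := Finset.Icc (1 : ℤ) N ×ˢ Finset.Icc (1 : ℤ) J with hD_def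
  have hmemD : ∀ p ∈ D \ Bad, (1 ≤ p.1 ∧ p.1 ≤ (N : ℤ)) ∧ (1 ≤ p.2 ∧ p.2 ≤ (J : ℤ)) := by
    intro p hp
    have h := (Finset.mem_sdiff.1 hp).1
    rw [hD_def, Finset.mem_product, Finset.mem_Icc, Finset.mem_Icc] at h
    exact h
  have hR : (0 : ℝ) < N * a + J * b + 1 := by
    have h1 := mul_nonneg (Nat.cast_nonneg (α := ℝ) N) ha
    have h2 := mul_nonneg (Nat.cast_nonneg (α := ℝ) J) hb
    linarith
  refine ⟨N * a + J * b + 1, (D \ Bad).image f, hR, ?_, ?_⟩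
  · -- (6)-(7) the count: `2 #Z ≥ #(D \ Bad) ≥ N J - K > 2 (C₂⁺ R + C₁⁺)`
    have hD : (D.card : ℝ) = N * J := by
      rw [hD_def, Finset.card_product, Int.card_Icc, Int.card_Icc]
      simp
    have hGood1 : (N : ℝ) * J - Bad.card ≤ (D \ Bad).card := by
      have h : (D.card : ℝ) ≤ (D \ Bad).card + Bad.card := by
        exact_mod_cast Finset.card_le_card_sdiff_add_card
      linarith
    have hGood2 : ((D \ Bad).card : ℝ) ≤ 2 * ((D \ Bad).image f).card := by
      have h : (D \ Bad).card ≤ 2 * ((D \ Bad).image f).card := by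
        refine card_le_two_mul_card_image (D \ Bad) f g fun p hp q hq hpq => hfib p q hpq ?_
        -- two good points with the same value lie on the same line
        by_contra hne
        refine (Finset.mem_sdiff.1 hp).2 ((hbad J).mem_toFinset.2 ?_)
        exact ⟨(hmemD p hp).2, q, (hmemD q hq).2, fun h => hne h.symm, hpq⟩
      exact_mod_cast h
    have h3 : (N : ℝ) * (2 * max C₂ 0 * a + 1) ≤ N * J :=
      mul_le_mul_of_nonneg_left hJ (Nat.cast_nonneg N)
    have h4 : C₂ * (N * a + J * b + 1) ≤ max C₂ 0 * (N * a + J * b + 1) :=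
      mul_le_mul_of_nonneg_right hc₂ hR.le
    linarith
  · -- (5) every value is the norm of a nonzero lattice point and is at most `R`
    intro s hs
    obtain ⟨⟨n, j⟩, hp, rfl⟩ := Finset.mem_image.1 hs
    obtain ⟨⟨hn1, hnN⟩, hj1, hjJ⟩ : (1 ≤ n ∧ n ≤ (N : ℤ)) ∧ (1 ≤ j ∧ j ≤ (J : ℤ)) :=
      hmemD (n, j) hp
    refine ⟨?_, n, j, fun h => ?_, rfl⟩
    · have hn1' : (1 : ℝ) ≤ n := by exact_mod_cast hn1
      have hj1' : (1 : ℝ) ≤ j := by exact_mod_cast hj1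
      have hn : |((n : ℤ) : ℝ)| ≤ N := by
        rw [abs_of_pos (by linarith)]
        exact_mod_cast hnN
      have hj : |((j : ℤ) : ℝ)| ≤ J := by
        rw [abs_of_pos (by linarith)]
        exact_mod_cast hjJ
      calc f (n, j) ≤ a * |(n : ℝ)| + b * |(j : ℝ)| := hf (n, j)
        _ ≤ a * N + b * J :=
          add_le_add (mul_le_mul_of_nonneg_left hn ha) (mul_le_mul_of_nonneg_left hj hb)
        _ ≤ N * a + J * b + 1 := by linarith
    · have := (Prod.mk.inj h).1
      omega

/-- Stub S5 (distinct norms of a rank-2 lattice are superlinear).  GIVEN the finiteness of the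
cross-line coincidences (the statement of stub `stub_coincidenceFinite`, taken verbatim as a
hypothesis), for independent `k₁, k₂ ∈ ℝ³` and all constants `C₁, C₂` there are a radius `R > 0`
and MORE THAN `C₂ R + C₁` distinct reals `s ≤ R`, each a norm `‖n k₁ + j k₂‖` with
`(n, j) ≠ (0, 0)`. [folklore] -/
theorem stub_normsSuperlinear :
    (∀ (A B C : ℝ) (j j' : ℤ), 0 < A → B ^ 2 < A * C → 0 ≤ j → j < j' →
      Set.Finite {p : ℤ × ℤ | A * (p.1 : ℝ) ^ 2 + 2 * B * (j : ℝ) * (p.1 : ℝ) + C * (j : ℝ) ^ 2 =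
        A * (p.2 : ℝ) ^ 2 + 2 * B * (j' : ℝ) * (p.2 : ℝ) + C * (j' : ℝ) ^ 2}) →
    ∀ (k₁ k₂ : EuclideanSpace ℝ (Fin 3)), LinearIndependent ℝ ![k₁, k₂] →
    ∀ C₁ C₂ : ℝ, ∃ (R : ℝ) (Z : Finset ℝ), 0 < R ∧ C₂ * R + C₁ < (Z.card : ℝ) ∧
      ∀ s ∈ Z, s ≤ R ∧ ∃ n j : ℤ, (n, j) ≠ (0, 0) ∧ s = ‖(n : ℝ) • k₁ + (j : ℝ) • k₂‖ := by
  intro hfin k₁ k₂ hli C₁ C₂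
  obtain ⟨hA, hBAC⟩ := gram_pos hli
  refine core (fun p : ℤ × ℤ => ‖(p.1 : ℝ) • k₁ + (p.2 : ℝ) • k₂‖)
    (fun p : ℤ × ℤ => (⌊-2 * ⟪k₁, k₂⟫ * (p.2 : ℝ) / ‖k₁‖ ^ 2 - (p.1 : ℝ)⌋, p.2)) ‖k₁‖ ‖k₂‖
    (norm_nonneg _) (norm_nonneg _) (fun p => ?_) ?_ (fun J => ?_) C₁ C₂
  · -- the norm bound `‖n k₁ + j k₂‖ ≤ ‖k₁‖ |n| + ‖k₂‖ |j|`
    calc ‖(p.1 : ℝ) • k₁ + (p.2 : ℝ) • k₂‖ ≤ ‖(p.1 : ℝ) • k₁‖ + ‖(p.2 : ℝ) • k₂‖ :=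
          norm_add_le _ _
      _ = ‖k₁‖ * |(p.1 : ℝ)| + ‖k₂‖ * |(p.2 : ℝ)| := by
        rw [norm_smul, norm_smul, Real.norm_eq_abs, Real.norm_eq_abs]; ring
  · -- same-line fibres have at most two points
    rintro ⟨n, j⟩ ⟨m, i⟩ hpq hji
    have hij : i = j := (hji : j = i).symm
    rw [hij] at hpq ⊢
    have hQ : ‖(n : ℝ) • k₁ + (j : ℝ) • k₂‖ ^ 2 = ‖(m : ℝ) • k₁ + (j : ℝ) • k₂‖ ^ 2 :=
      congrArg (fun x : ℝ => x ^ 2) hpq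
    rw [norm_sq_eq, norm_sq_eq] at hQ
    rcases same_line hA hQ with h | h
    · exact Or.inl (Prod.ext h rfl)
    · exact Or.inr (Prod.ext h rfl)
  · -- the cross-line coincidence points among the lines `1 ≤ j ≤ J` are finitely many
    refine (bad_finite (fun n j => ‖k₁‖ ^ 2 * (n : ℝ) ^ 2 + 2 * ⟪k₁, k₂⟫ * (j : ℝ) * (n : ℝ) +
      ‖k₂‖ ^ 2 * (j : ℝ) ^ 2) (fun j j' hj hjj' =>
        hfin (‖k₁‖ ^ 2) ⟪k₁, k₂⟫ (‖k₂‖ ^ 2) j j' hA hBAC hj hjj') J).subset ?_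
    rintro p ⟨hp, q, hq, hne, hpq⟩
    refine ⟨hp, q, hq, hne, ?_⟩
    have hQ : ‖(p.1 : ℝ) • k₁ + (p.2 : ℝ) • k₂‖ ^ 2 = ‖(q.1 : ℝ) • k₁ + (q.2 : ℝ) • k₂‖ ^ 2 :=
      congrArg (fun x : ℝ => x ^ 2) hpq
    rw [norm_sq_eq, norm_sq_eq] at hQ
    exact hQ

end Summit.AtomisticToContinuum.Crystallization.Theorems.ThreeConeCertificateExactCertificate.Invisibility
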